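import Literature.Barriers.CriticalPhenomena.WeaklySAWFourDimLogCorrectionsCesaroProofs
import Literature.Barriers.CriticalPhenomena.WeaklySAWFourDimLogCorrectionsAssembly
import Literature.Barriers.CriticalPhenomena.WeaklySAWSubmultiplicativity
import HarnessLib

/-!
# BBS 2015, §1.3: the corrected Cesàro asymptotics of `c_T` — what is proved unconditionally,
# and its derivation from Theorem 4.1 alone

Companion (theorems only) to `WeaklySAWFourDimLogCorrectionsCesaro.lean`, which vendors the
sign-corrected reading `CTWSAW.BBS2015_cesaro_corrected` of the first display of §1.3 of
R. Bauerschmidt, D. C. Brydges, G. Slade, *Logarithmic correction for the susceptibility of the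
4-dimensional weakly self-avoiding walk: a renormalisation group analysis*, CMP 337 (2015),
arXiv:1403.7422 ("For `d = 4`, Theorem 1.1 and a standard Tauberian theorem [Fell71] imply that
`T⁻¹∫₀ᵀ c_S e^{-ν_c S} dS ∼ A_g (log T)^{1/4}`", sign of `ν_c` as forced by (1.3)), and to
`WeaklySAWFourDimLogCorrectionsCesaroProofs.lean` (the Tauberian step
`BBS2015_cesaro_corrected_of_thm11`).

## The dependency chain of `BBS2015_cesaro_corrected` (triage of its discharge: XL)

`BBS2015_cesaro_corrected` ⇐ Theorem 1.1 (`BBS2015_thm11`; the Tauberian step is proved) ⇐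
Theorem 4.1 (`BBS2015_thm41`) + Proposition 4.2(ii) + Lemma 4.3 + Lemma 2.1 (part) + (1.8)
(`BBS2015_thm11_of_thm41`, `…Reduction.lean`; Lemma 4.3, Lemma 2.1 (part) and (1.8) are proved in
the tree, and Proposition 4.2(ii) is proved from Theorem 4.1's conclusions and the clause
`χ(g,ν) < ∞ ↔ ν > ν_c(g)` of Lemma A.1, `BBS2015_prop42ii_of_lt_top_iff`, `…ChangeOfParameters.lean`).
That clause of Lemma A.1 is itself proved in the tree (`susceptibility_lt_top_iff`,
`WeaklySAWSubmultiplicativity.lean`, from the sub-multiplicativity `c_{T+S} ≤ c_T c_S` of the proof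
of Lemma A.1). Hence:

* `CTWSAW.BBS2015_prop42ii_holds : BBS2015_prop42ii` — Proposition 4.2(ii) (relative to Theorem
  4.1's data, as vendored) is now an unconditional theorem;
* `CTWSAW.BBS2015_thm41.thm11 : BBS2015_thm41 → BBS2015_thm11` — **Theorem 1.1, and with it the
  barrier `WeaklySAWFourDimLogCorrections` (`BBS2015_thm41.barrier`), follow from Theorem 4.1
  ALONE**, every other input of the printed proof being proved in the tree;
* `CTWSAW.BBS2015_thm41.cesaro_corrected : BBS2015_thm41 → BBS2015_cesaro_corrected` — the
  Cesàro asymptotics of §1.3 from Theorem 4.1 alone (and `BBS2015_cesaro_corrected_of_thm41_lemA1`,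
  the same through the older assembly `BBS2015_thm11_of_thm41_lemA1`);
* `CTWSAW.BBS2015_thm11.cesaro_corrected_sharp`, `CTWSAW.BBS2015_thm41.cesaro_corrected_sharp` —
  the display with its PRINTED constant: one `A = A_g` per `g`, obeying (1.10)
  `|A/(𝖻g)^{1/4} - 1| ≤ Kg`, serving both (1.9) and the Cesàro asymptotics (the named fact
  `BBS2015_cesaro_corrected` keeps only "some `A > 0`"; no new named fact is introduced for the
  sharp reading — it is recorded as these proved implications).

Theorem 4.1 is the renormalisation-group theorem of the source ("whose proof occupies the
remainder of the paper", §5–§8, resting on the companion series [BS-rg-norm, BS-rg-loc, BBS-rg-pt,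
BS-rg-IE, BS-rg-step, BBS-rg-flow]); it is the single remaining named input of
`BBS2015_cesaro_corrected` and is not formalised (see `…Reduction.lean` for the triage).

## What is proved unconditionally about the corrected Cesàro mean (`c_T ≥ e^{ν_c T}`)

The proof of Lemma A.1 (Appendix A) prints, right after the display `c_{T+S} ≤ c_T c_S`: "A
standard lemma for subadditive functions now yields the existence of a critical value `ν_c` …
such that `c_T^{1/T} → e^{ν_c}` and also `c_T ≥ e^{ν_c T}` (see, e.g., [MS93])". The inequality
`c_T ≥ e^{ν_c T}` follows from the tree's sub-multiplicativity consequences without Fekete's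
lemma: if `c_{T₀} e^{-ν_c T₀} < 1` for some `T₀ > 0` then `χ(g, ν_c) < ∞`
(`susceptibility_lt_top_of_ratio_lt_one`), contradicting `χ(g, ν_c) = ∞`
(`susceptibility_criticalNu_eq_top`). Consequences for the integrand of `BBS2015_cesaro_corrected`:
`c_S e^{-ν_c S} ≥ 1`, so `∫₀ᵀ c_S e^{-ν_c S} dS ≥ T` and the corrected Cesàro mean
`T⁻¹∫₀ᵀ c_S e^{-ν_c S} dS` is `≥ 1` for every `T > 0` (all `d ≥ 1`, `g ≥ 0`) — in contrast with the
literal transcription `T⁻¹∫₀ᵀ c_S e^{+ν_c S} dS → 0` refuted in `…Decay.lean`. Under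
`BBS2015_cesaro_corrected` the corrected Cesàro mean tends to `∞` (like `A_g (log T)^{1/4}`):
`BBS2015_cesaro_corrected.tendsto_cesaroMean_atTop`.

## References

* Bauerschmidt–Brydges–Slade 2015, §1.1 (1.3), Theorem 1.1, §1.3, Theorem 4.1, Proposition 4.2,
  Appendix A (Lemma A.1 and its proof: `c_{T+S} ≤ c_T c_S`, `c_T ≥ e^{ν_c T}`).
  [cite: BauerschmidtBrydgesSlade2015LogCorr]
* N. Madras, G. Slade, *The Self-Avoiding Walk*, Birkhäuser 1993, Lemma 1.2.2 (the subadditive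
  lemma cited as [MS93] at that point of the source).
-/

noncomputable section

open MeasureTheory Filter Topology Set
open scoped ENNReal

namespace Literature.Barriers.CriticalPhenomena

namespace CTWSAW

variable {d : ℕ}

/-! ### `c_T ≥ e^{ν_c T}` (proof of Lemma A.1), and the corrected Cesàro mean is at least `1` -/

/-- **`c_T ≥ e^{ν_c T}` (proof of Lemma A.1), in the form `1 ≤ c_T e^{-ν_c T}`** (`d ≥ 1`,
`g ≥ 0`, `T > 0`): otherwise `c_T e^{-ν_c T} < 1` would give `χ(g, ν_c) < ∞` by the geometric
comparison over time blocks (sub-multiplicativity `c_{T+S} ≤ c_T c_S`), whereas `χ(g, ν_c) = ∞`.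
[cite: BauerschmidtBrydgesSlade2015LogCorr, Appendix A (proof of Lemma A.1: c_T ≥ e^{ν_c T}, after the display c_{T+S} ≤ c_T c_S)] -/
theorem one_le_survival_mul_exp_neg_criticalNu (hd : 0 < d) {g : ℝ} (hg : 0 ≤ g) {T : ℝ}
    (hT : 0 < T) :
    1 ≤ survival d g T * ENNReal.ofReal (Real.exp (-criticalNu d g * T)) := by
  by_contra h
  exact (susceptibility_lt_top_of_ratio_lt_one hg d hT (not_le.mp h)).ne
    (susceptibility_criticalNu_eq_top hd hg)

/-- **`e^{ν_c T} ≤ c_T`, as printed in the proof of Lemma A.1** (`d ≥ 1`, `g ≥ 0`, `T > 0`).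
[cite: BauerschmidtBrydgesSlade2015LogCorr, Appendix A (proof of Lemma A.1: c_T ≥ e^{ν_c T})] -/
theorem exp_criticalNu_mul_le_survival (hd : 0 < d) {g : ℝ} (hg : 0 ≤ g) {T : ℝ} (hT : 0 < T) :
    ENNReal.ofReal (Real.exp (criticalNu d g * T)) ≤ survival d g T := by
  have h := one_le_survival_mul_exp_neg_criticalNu hd hg hT
  have hexp : ENNReal.ofReal (Real.exp (criticalNu d g * T)) *
      ENNReal.ofReal (Real.exp (-criticalNu d g * T)) = 1 := by
    rw [← ENNReal.ofReal_mul (Real.exp_pos _).le, ← Real.exp_add, neg_mul, add_neg_cancel,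
      Real.exp_zero, ENNReal.ofReal_one]
  calc ENNReal.ofReal (Real.exp (criticalNu d g * T))
      = ENNReal.ofReal (Real.exp (criticalNu d g * T)) * 1 := (mul_one _).symm
    _ ≤ ENNReal.ofReal (Real.exp (criticalNu d g * T)) *
          (survival d g T * ENNReal.ofReal (Real.exp (-criticalNu d g * T))) :=
        mul_le_mul' le_rfl h
    _ = survival d g T * (ENNReal.ofReal (Real.exp (criticalNu d g * T)) *
          ENNReal.ofReal (Real.exp (-criticalNu d g * T))) := by ring
    _ = survival d g T := by rw [hexp, mul_one]

/-- `c_S ≥ e^{ν_c S}` integrated: **`T ≤ ∫₀ᵀ c_S e^{-ν_c S} dS`** — the numerator of the corrected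
Cesàro statement is at least `T` (`d ≥ 1`, `g ≥ 0`; for `T ≤ 0` both sides vanish in `ℝ≥0∞`).
[cite: BauerschmidtBrydgesSlade2015LogCorr, Appendix A (proof of Lemma A.1: c_T ≥ e^{ν_c T}) and §1.3 (Cesàro average of c_T)] -/
theorem ofReal_le_lintegral_survival_mul_exp (hd : 0 < d) {g : ℝ} (hg : 0 ≤ g) (T : ℝ) :
    ENNReal.ofReal T ≤
      ∫⁻ S in Ioc 0 T, survival d g S * ENNReal.ofReal (Real.exp (-criticalNu d g * S)) := by
  calc ENNReal.ofReal T = ∫⁻ _ in Ioc (0 : ℝ) T, (1 : ℝ≥0∞) := by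
        rw [setLIntegral_one, Real.volume_Ioc, sub_zero]
    _ ≤ ∫⁻ S in Ioc 0 T, survival d g S * ENNReal.ofReal (Real.exp (-criticalNu d g * S)) :=
        setLIntegral_mono' measurableSet_Ioc fun S hS =>
          one_le_survival_mul_exp_neg_criticalNu hd hg hS.1

/-- `∫₀ᵀ c_S e^{-νS} dS < ∞` for every `ν` and `T` (`g ≥ 0`: `c_S ≤ 1` and `e^{-νS} ≤ e^{|ν||T|}`
on `(0, T]`). [folklore] -/
theorem lintegral_Ioc_survival_mul_exp_lt_top {g : ℝ} (hg : 0 ≤ g) (d : ℕ) (ν T : ℝ) :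
    ∫⁻ S in Ioc 0 T, survival d g S * ENNReal.ofReal (Real.exp (-ν * S)) < ∞ := by
  refine lt_of_le_of_lt (setLIntegral_mono' (g := fun _ => ENNReal.ofReal (Real.exp (|ν| * |T|)))
    measurableSet_Ioc fun S hS => ?_) ?_
  · calc survival d g S * ENNReal.ofReal (Real.exp (-ν * S))
        ≤ 1 * ENNReal.ofReal (Real.exp (|ν| * |T|)) := by
          refine mul_le_mul' (survival_le_one hg d hS.1)
            (ENNReal.ofReal_le_ofReal (Real.exp_le_exp.2 ?_))
          calc -ν * S ≤ |-ν * S| := le_abs_self _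
            _ = |ν| * |S| := by rw [abs_mul, abs_neg]
            _ ≤ |ν| * |T| := by
                refine mul_le_mul_of_nonneg_left ?_ (abs_nonneg _)
                rw [abs_of_pos hS.1]
                exact hS.2.trans (le_abs_self T)
      _ = ENNReal.ofReal (Real.exp (|ν| * |T|)) := one_mul _
  · rw [setLIntegral_const]
    exact ENNReal.mul_lt_top ENNReal.ofReal_lt_top measure_Ioc_lt_top

/-- **The corrected Cesàro mean is at least `1`**: `1 ≤ T⁻¹∫₀ᵀ c_S e^{-ν_c S} dS` for every
`T > 0` (`d ≥ 1`, `g ≥ 0`) — whereas the literal transcription `T⁻¹∫₀ᵀ c_S e^{+ν_c S} dS` tends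
to `0` (`not_BBS2015_cesaro`, `…Decay.lean`). Unconditional; the source's Theorem 1.1 upgrades
`≥ 1` to `∼ A_g (log T)^{1/4}` (`BBS2015_thm41.cesaro_corrected`).
[cite: BauerschmidtBrydgesSlade2015LogCorr, Appendix A (proof of Lemma A.1: c_T ≥ e^{ν_c T}) and §1.3 (Cesàro average of c_T)] -/
theorem one_le_cesaroMean (hd : 0 < d) {g : ℝ} (hg : 0 ≤ g) {T : ℝ} (hT : 0 < T) :
    1 ≤ (∫⁻ S in Ioc 0 T,
        survival d g S * ENNReal.ofReal (Real.exp (-criticalNu d g * S))).toReal / T := by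
  rw [le_div_iff₀ hT, one_mul]
  calc T = (ENNReal.ofReal T).toReal := (ENNReal.toReal_ofReal hT.le).symm
    _ ≤ _ := ENNReal.toReal_mono (lintegral_Ioc_survival_mul_exp_lt_top hg d _ T).ne
        (ofReal_le_lintegral_survival_mul_exp hd hg T)

/-- Under `BBS2015_cesaro_corrected` the corrected Cesàro mean diverges:
`T⁻¹∫₀ᵀ c_S e^{-ν_c S} dS → ∞` as `T → ∞` (`d = 4`, all sufficiently small `g > 0`), since it is
`∼ A (log T)^{1/4}` with `A > 0`. [cite: BauerschmidtBrydgesSlade2015LogCorr, §1.3 (Cesàro average of c_T)] -/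
theorem BBS2015_cesaro_corrected.tendsto_cesaroMean_atTop (h : BBS2015_cesaro_corrected) :
    ∃ g₀ : ℝ, 0 < g₀ ∧ ∀ g : ℝ, 0 < g → g < g₀ →
      Tendsto (fun T : ℝ =>
          (∫⁻ S in Ioc 0 T,
              survival 4 g S * ENNReal.ofReal (Real.exp (-criticalNu 4 g * S))).toReal / T)
        atTop atTop := by
  obtain ⟨g₀, hg₀, hg⟩ := h
  refine ⟨g₀, hg₀, fun g hg0 hgg => ?_⟩
  obtain ⟨A, hA, hT⟩ := hg g hg0 hgg
  have hlog : Tendsto (fun T : ℝ => A * Real.log T ^ (1 / 4 : ℝ)) atTop atTop :=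
    ((tendsto_rpow_atTop (by norm_num : (0 : ℝ) < 1 / 4)).comp Real.tendsto_log_atTop).const_mul_atTop
      hA
  refine (hT.pos_mul_atTop one_pos hlog).congr' ?_
  filter_upwards [eventually_gt_atTop 1] with T hT1
  have hT0 : (T : ℝ) ≠ 0 := by positivity
  have hA0 : A ≠ 0 := hA.ne'
  have hL : Real.log T ^ (1 / 4 : ℝ) ≠ 0 := (Real.rpow_pos_of_pos (Real.log_pos hT1) _).ne'
  field_simp

/-! ### Proposition 4.2(ii) and Theorem 1.1 from Theorem 4.1 alone -/

/-- **Proposition 4.2(ii)** (relative to Theorem 4.1's data, as vendored in `BBS2015_prop42ii`)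
**holds unconditionally**: its proof `BBS2015_prop42ii_of_lt_top_iff` needs only the clause
`χ(g,ν) < ∞ ↔ ν > ν_c(g)` of Lemma A.1, which is `susceptibility_lt_top_iff`.
[cite: BauerschmidtBrydgesSlade2015LogCorr, Proposition 4.2 and Lemma A.1] -/
theorem BBS2015_prop42ii_holds : BBS2015_prop42ii :=
  BBS2015_prop42ii_of_lt_top_iff fun _ hg ν => susceptibility_lt_top_iff (by norm_num) hg.le ν

/-- **Theorem 1.1 from Theorem 4.1 alone**: the source's "Proof of Theorem 1.1" (§4.3,
`BBS2015_thm11_of_thm41`) with all its other inputs discharged in the tree — Proposition 4.2(ii)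
(`BBS2015_prop42ii_holds`), the used part of Lemma 2.1 (`BBS2015_lem21_holds`) and (1.8)
(`BBS2015_eq18_holds`). [cite: BauerschmidtBrydgesSlade2015LogCorr, Theorem 1.1, §4.2–§4.3] -/
theorem BBS2015_thm41.thm11 (h : BBS2015_thm41) : BBS2015_thm11 :=
  BBS2015_thm11_of_thm41 h BBS2015_prop42ii_holds BBS2015_lem21_holds BBS2015_eq18_holds

/-- The barrier `WeaklySAWFourDimLogCorrections` (= Theorem 1.1) from Theorem 4.1 alone.
[cite: BauerschmidtBrydgesSlade2015LogCorr, Theorem 1.1 and Theorem 4.1] -/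
theorem BBS2015_thm41.barrier (h : BBS2015_thm41) : WeaklySAWFourDimLogCorrections :=
  h.thm11

/-! ### The Cesàro asymptotics from Theorem 4.1 alone -/

/-- **`BBS2015_thm41 → BBS2015_cesaro_corrected`**: the Cesàro asymptotics of §1.3 (sign of `ν_c`
as forced by (1.3)) from Theorem 4.1 alone — Theorem 1.1 from Theorem 4.1 (`BBS2015_thm41.thm11`)
and the Tauberian step (`BBS2015_cesaro_corrected_of_thm11`, Karamata–Feller XIII.5 Theorem 2).
Theorem 4.1, the renormalisation-group theorem, is the single remaining named input.
[cite: BauerschmidtBrydgesSlade2015LogCorr, §1.3 (Cesàro average of c_T), Theorem 1.1, Theorem 4.1] -/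
theorem BBS2015_thm41.cesaro_corrected (h : BBS2015_thm41) : BBS2015_cesaro_corrected :=
  BBS2015_cesaro_corrected_of_thm11 h.thm11

/-- The same through the older assembly `BBS2015_thm11_of_thm41_lemA1` (Theorem 4.1 and the full
Lemma A.1). [cite: BauerschmidtBrydgesSlade2015LogCorr, §1.3, Theorem 1.1, Theorem 4.1, Lemma A.1] -/
theorem BBS2015_cesaro_corrected_of_thm41_lemA1 (h41 : BBS2015_thm41) (hA : BBS2015_lemA1) :
    BBS2015_cesaro_corrected :=
  BBS2015_cesaro_corrected_of_thm11 (BBS2015_thm11_of_thm41_lemA1 h41 hA)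

/-- **The Cesàro display of §1.3 with its printed constant `A_g`**, from Theorem 1.1: in print the
Cesàro asymptotics carries the SAME constant `A_g` as (1.9), with `A_g = (𝖻g)^{1/4}(1 + O(g))`
(1.10), whereas the named fact `BBS2015_cesaro_corrected` records only "some `A > 0`". The joint
conclusion — one `A = A_g` per `g`, with the (1.10) bound, serving both (1.9) and the Cesàro
asymptotics — follows from `BBS2015_thm11`, because the Tauberian step
`tendsto_cesaro_of_tendsto_susceptibility` preserves the constant.
[cite: BauerschmidtBrydgesSlade2015LogCorr, §1.3 (Cesàro average of c_T, constant A_g) with Theorem 1.1 (1.9)–(1.10)] -/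
theorem BBS2015_thm11.cesaro_corrected_sharp (h : BBS2015_thm11) :
    ∃ g₀ K : ℝ, 0 < g₀ ∧ ∀ g : ℝ, 0 < g → g < g₀ →
      ∃ A : ℝ, 0 < A ∧ |A / (freeBubbleB * g) ^ (1 / 4 : ℝ) - 1| ≤ K * g ∧
        Tendsto (fun ε : ℝ =>
            (susceptibility 4 g (criticalNu 4 g + ε)).toReal /
              (A * ε⁻¹ * Real.log ε⁻¹ ^ (1 / 4 : ℝ)))
          (𝓝[>] 0) (𝓝 1) ∧
        Tendsto (fun T : ℝ =>
            (∫⁻ S in Ioc 0 T,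
                survival 4 g S * ENNReal.ofReal (Real.exp (-criticalNu 4 g * S))).toReal /
              (T * (A * Real.log T ^ (1 / 4 : ℝ))))
          atTop (𝓝 1) := by
  obtain ⟨g₀, K, hg₀, hg⟩ := h
  refine ⟨g₀, K, hg₀, fun g hg0 hgg => ?_⟩
  obtain ⟨A, hA, hK, hT⟩ := hg g hg0 hgg
  exact ⟨A, hA, hK, hT, tendsto_cesaro_of_tendsto_susceptibility hA hT⟩

/-- The Cesàro display of §1.3 with its printed constant `A_g` (jointly with (1.9)–(1.10)), from
Theorem 4.1 alone. [cite: BauerschmidtBrydgesSlade2015LogCorr, §1.3 (Cesàro average of c_T, constant A_g), Theorem 1.1, Theorem 4.1] -/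
theorem BBS2015_thm41.cesaro_corrected_sharp (h : BBS2015_thm41) :
    ∃ g₀ K : ℝ, 0 < g₀ ∧ ∀ g : ℝ, 0 < g → g < g₀ →
      ∃ A : ℝ, 0 < A ∧ |A / (freeBubbleB * g) ^ (1 / 4 : ℝ) - 1| ≤ K * g ∧
        Tendsto (fun ε : ℝ =>
            (susceptibility 4 g (criticalNu 4 g + ε)).toReal /
              (A * ε⁻¹ * Real.log ε⁻¹ ^ (1 / 4 : ℝ)))
          (𝓝[>] 0) (𝓝 1) ∧
        Tendsto (fun T : ℝ =>
            (∫⁻ S in Ioc 0 T,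
                survival 4 g S * ENNReal.ofReal (Real.exp (-criticalNu 4 g * S))).toReal /
              (T * (A * Real.log T ^ (1 / 4 : ℝ))))
          atTop (𝓝 1) :=
  h.thm11.cesaro_corrected_sharp

end CTWSAW

end Literature.Barriers.CriticalPhenomena
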